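import Summits.QuantumFields.YangMills.Theorems.BalabanUVNodesSpineReadingOfRecord13CoPHKComponentSizeBlocksFreshTowerFar

/-!
# THE NEAR-LABEL SUM SPLIT INTO PRINT's THREE SINGLE-CUBE FACTORS: the one-step label mass with a new large-field cube near `c` is at most the sum, over the candidate cubes `□`,
# of the (3.2) factor `1 − χ_□` (the new small-field condition fails on `□`), the (3.3) factor `χ′ᶜ_□` (the approximate fluctuation on `□^{∼2}` is large) and the (3.16) residual
# `ζ`-mass on `{(R,S) : □ ∈ R}` (the fluctuation field is large on `□`) — so the letter hLFc of `…BlocksFreshTowerFar` is three printed-kind letters, one per label type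

Cell `pub-ymgap`, YM-PLAN Track A (HUMAN RULING D-0062; width push D-0149); seat `pub-ymgap-dag-n20-d` (R134 (a) N20 NE7b s3 = the U5d ∕ `crOfRecord₁₃` lineage, its declarer)
gen 38.  `--kind proof --supports stmt-QuantumFields-27366 --as helper` (K3⁸); COUNT-NEUTRAL; THEOREMS ONLY (0 `def`).  [III] = [Balaban1988Convergent]; [LF-II] = [Balaban1989LargeFieldII].
Companion of `…BlocksFreshTowerFar` (gen 38, p767158: the repaired per-history letter ⇐ hLFc on the near-label sum `F_T`), `…BlocksFreshTowerLabel` (p766321: §1 superset sums,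
§2 `Σ_{P ⊇ C} a(P) = Π(1 − χ)`), `Node00.StepWeightsOfRecord` (n02-b ∕ def-T: `aWeight`, `bWeight`, `ωOfRecord`, `sum_aWeight`, `sum_bWeight`, `front_absorb`).

WHAT IS HERE (pointwise in `(U, V′)`, of record; then the letter).  §1 per label TYPE, for one χ_{k+1}-cube `□`: ★ `sum_filter_memP_chi_mul_ωOfRecord_le` (`Σ_{t : □ ∈ P_t} χ·ω ≤ 1 − χ_□(V′)`;
`= ` when `□` is in the (3.2) range, `0` otherwise), `sum_ite_mem_bWeight_eq` (`Σ_{Q ∋ □} b(P,Q) = [□ ∈ (3.3)-range of P]·χ′ᶜ_□(U,V′)`, the (3.3) twin of `…Label`'s §2), ★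
`sum_filter_memQ_chi_mul_ωOfRecord_le` (`Σ_{t : □ ∈ Q_t} χ·ω ≤ χ′ᶜ_□(U,V′)` = `1` iff the approximate fluctuation `dist1(U_b·(V_□ V′)_b⁻¹) ≥ 2δ_k` for some bond of `□^{∼2}`), ★
`sum_filter_memR_chi_mul_ωOfRecord_eq` (`Σ_{t : □ ∈ R_t} χ·ω = Σ_{P,Q} a(P)·b(P,Q)·Σ_{(R,S) : □ ∈ R} ζ(P,Q,(R,S))` — the residual's own mass on `□`).  §2 ★★ `nearLabelSum_le_split`: for the
label set `T_c = {t : ∃ □ ∈ P_t ∪ Q_t ∪ R_t near c}` and the cube set `N_c = {□ near c}`: `F_{T_c}(U,V′) ≤ Σ_{□ ∈ N_c} [(1 − χ_□(V′)) + χ′ᶜ_□(U,V′) + ζR_□(U,V′)]`.  §3 ★★★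
`sum_meets_classWeightOfDatum₉_succ_le_of_threeLetters_of_ppSelLive`: the repaired per-history letter of `…Far` from THREE letters — hP: `∫ χ_k(s)·slot_k(s)·Σ_{□∈N_c}(1 − χ_□(avg U)) ≤ δP·cw`,
hQ: `∫ χ_k(s)·slot_k(s)·Σ_{□∈N_c} χ′ᶜ_□(U, avg U) ≤ δQ·cw`, hR: `∫ χ_k(s)·slot_k(s)·Σ_{□∈N_c} ζR_□(U, avg U) ≤ δR·cw` ⟹ `Σ_{s′ : init = s, c ∩ Z_{k+1}(s′) ≠ ∅} cw_{k+1}(s′) ≤ (δP + δQ + δR)·cw_k(s)`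
(the three integrands displayed integrable — they are bounded measurable against an integrable piece, but the statement keeps the proviso visible).

HONEST FRAMING.  [bookkeeping] finite sums BY NAME; hP ∕ hQ ∕ hR are HYPOTHESES — the three new-region small factors of [LF-II] (1.79) p. 383 (largest of them `exp(−¼γ₀[…]⁻¹A₁²p₀²(g_j))`,
«we estimate the factors by exp(−p₀(g_j))») read on ONE history's class density; ESTIMATES on Theorem 1 [III]'s form of the slots and on the residual `ζ` (which has no body in the
tree), nobody's theorems today; NO weight is bounded, NO estimate proved; nothing of Bałaban's asserted; NE7 ∕ NE7b ∕ NE7c NOT PRINTED for `d = 4` ∕ NOT proved; no `Provisos₁₃CoPH` ∕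
`Stage9Params.Provisos` inhabitant claimed (K0⁷ OPEN); K3⁸ v7 untouched; N19 ∕ N20 ∕ N21 ∕ N27 NOT discharged; counts UNMOVED (typed 28∕28 · discharged 8∕27); one finite four-torus
programme at fixed `ε` — NOT ℝ⁴, NOT OS, NOT a mass gap, NOT the Clay problem.  No `def`, no `instance`, no `notation`, no `sorry`; no decl below carries a cite tag.
-/

noncomputable section

open MeasureTheory
open scoped BigOperators
open Finset

namespace YMDAG.UVSplit

open Literature.MathematicalPhysics.QuantumFieldTheory.Balaban1983to89
open Literature.MathematicalPhysics.QuantumFieldTheory.Balaban1983to89.T4Continuum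
open Literature.MathematicalPhysics.QuantumFieldTheory.Balaban1983to89.Node00
open Literature.MathematicalPhysics.QuantumFieldTheory.Balaban1983to89.B14.Eq218Concrete
open Literature.MathematicalPhysics.QuantumFieldTheory.Balaban1983to89.B14.Sect3Decomp
open Literature.MathematicalPhysics.QuantumFieldTheory.Balaban1983to89.B15Claim189LambdaPin (coordDist)
open Summit.QuantumFields.YangMills.BalabanUVNodes.N19MGFRoadLiveSelectorTower (dressedSlotsOfDatum₉_nonneg)

/-! ## §1 Per label type: the label sums over `{t : □ ∈ P_t}`, `{t : □ ∈ Q_t}`, `{t : □ ∈ R_t}` -/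

section PerType

variable (F : T4Family) (N : ℕ) [NeZero N] (ν : Stage7Numerics) (M : ℕ) (A₁ : ℝ) (p : B12.RunParams) (g : ℕ → ℝ) (k : ℕ)

open scoped Classical in
/-- ★ **P-TYPE**: `Σ_{t : □ ∈ P_t} χ_{k+1}(σ s t)(V′)·ω s t (U,V′) ≤ 1 − χ_□(V′)` — equality when `□` lies in the (3.2) range `cubes32 s` (`…Label`'s identity at `C = {□}`), and `0` otherwise
(a label with `P ⊄ cubes32 s` weighs `0`). [bookkeeping] -/
theorem sum_filter_memP_chi_mul_ωOfRecord_le {ζ : ZetaOfRecord F N ν M} (hζ : IsZetaUnity F N ν M ζ) (s : SeqOfRecord F ν M g p.K k) (q : Iχ F ν p g k)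
    (U : GaugeField (F.P p.K) k (SU N)) (V' : GaugeField (F.P p.K) (k + 1) (SU N)) :
    ∑ t ∈ Finset.univ.filter (fun t : LbOfRecord F ν p g k => q ∈ t.1),
        chiSeqOfRecord F N ν M g p.K (k + 1) (σOfRecord F ν M p g k s t) V' * ωOfRecord F N ν M p g k A₁ ζ s t U V' ≤ 1 - chiFactor F N ν p g k q V' := by
  by_cases hq : q ∈ cubes32 F ν M p g k s
  · have h := sum_filter_chi_mul_ωOfRecord_eq_prod F N ν M A₁ p g k hζ s {q} (Finset.singleton_subset_iff.2 hq) U V'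
    rw [Finset.prod_singleton] at h
    rw [← h]
    refine le_of_eq (Finset.sum_congr ?_ fun _ _ => rfl)
    ext t
    simp only [Finset.mem_filter, Finset.mem_univ, true_and, Finset.singleton_subset_iff]
  · refine le_trans (le_of_eq (Finset.sum_eq_zero fun t ht => ?_)) (sub_nonneg.2 (chiFactor_le_one F N ν p g k q V'))
    have hP : ¬ t.1 ⊆ cubes32 F ν M p g k s := fun h => hq (h (Finset.mem_filter.1 ht).2)
    rw [ωOfRecord, aWeight, if_neg hP, zero_mul, zero_mul, mul_zero]

open scoped Classical in
/-- **THE (3.3) SUPERSET SUM**: `Σ_{Q ∋ □} b(P,Q)(U,V′) = [□ ∈ qcubes P]·χ′ᶜ_□(U,V′)`, `χ′ᶜ_□ = 1` iff the approximate fluctuation is large on `□` (`…Label` §1's algebra with the (3.3) indicator).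
[bookkeeping] -/
theorem sum_ite_mem_bWeight_eq (s : SeqOfRecord F ν M g p.K k) (Pl : Finset (Iχ F ν p g k)) (q : Iχ F ν p g k)
    (U : GaugeField (F.P p.K) k (SU N)) (V' : GaugeField (F.P p.K) (k + 1) (SU N)) :
    (∑ Ql : Finset (Iχ F ν p g k), if q ∈ Ql then bWeight F N ν M p g k A₁ s Pl Ql U V' else 0) =
      if q ∈ qcubes F ν M p g k s Pl then
        (if SmallApproxFluct (sect3DataOfRecord F N ν M p g k s) (avOfRecord F N p.K) (2 * deltaOfRecord ν g k A₁) U V' q then (0 : ℝ) else 1) else 0 := by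
  classical
  set f : Iχ F ν p g k → ℝ := fun c =>
    if SmallApproxFluct (sect3DataOfRecord F N ν M p g k s) (avOfRecord F N p.K) (2 * deltaOfRecord ν g k A₁) U V' c then (1 : ℝ) else 0 with hf
  have hfc : ∀ c, (if SmallApproxFluct (sect3DataOfRecord F N ν M p g k s) (avOfRecord F N p.K) (2 * deltaOfRecord ν g k A₁) U V' c then (0 : ℝ) else 1) = 1 - f c :=
    fun c => by rw [hf]; simp only; split_ifs <;> norm_num
  have key : ∀ Ql : Finset (Iχ F ν p g k), (if q ∈ Ql then bWeight F N ν M p g k A₁ s Pl Ql U V' else 0) =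
      if Ql ∈ (qcubes F ν M p g k s Pl).powerset.filter (fun Qk => {q} ⊆ Qk) then
        (∏ c ∈ qcubes F ν M p g k s Pl \ Ql, f c) * ∏ c ∈ Ql, (1 - f c) else 0 := by
    intro Ql
    simp only [Finset.mem_filter, Finset.mem_powerset, Finset.singleton_subset_iff]
    by_cases hqQ : q ∈ Ql
    · by_cases hQ : Ql ⊆ qcubes F ν M p g k s Pl
      · rw [if_pos hqQ, if_pos ⟨hQ, hqQ⟩, bWeight, if_pos hQ]
        unfold chiPrime chiPrimec
        exact congrArg₂ (· * ·) rfl (Finset.prod_congr rfl fun c _ => hfc c)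
      · rw [if_pos hqQ, if_neg (fun h => hQ h.1), bWeight, if_neg hQ]
    · rw [if_neg hqQ, if_neg (fun h => hqQ h.2)]
  rw [Finset.sum_congr rfl (fun Ql _ => key Ql), ← Finset.sum_filter, Finset.filter_mem_eq_inter, Finset.univ_inter]
  by_cases hq : q ∈ qcubes F ν M p g k s Pl
  · rw [if_pos hq, sum_powerset_filter_superset_prod_mul_prod _ {q} (Finset.singleton_subset_iff.2 hq) f, Finset.prod_singleton, hfc]
  · rw [if_neg hq]
    refine Finset.sum_eq_zero fun Ql hQl => ?_
    exfalso
    have h := Finset.mem_filter.1 hQl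
    exact hq (Finset.mem_powerset.1 h.1 (Finset.singleton_subset_iff.1 h.2))

open scoped Classical in
/-- ★ **Q-TYPE**: `Σ_{t : □ ∈ Q_t} χ_{k+1}(σ s t)(V′)·ω s t (U,V′) ≤ χ′ᶜ_□(U,V′)` (front absorption, ζ-unity, `sum_ite_mem_bWeight_eq`, `a ≥ 0`, `Σ_P a(P) = 1`). [bookkeeping] -/
theorem sum_filter_memQ_chi_mul_ωOfRecord_le {ζ : ZetaOfRecord F N ν M} (hζ : IsZetaUnity F N ν M ζ) (s : SeqOfRecord F ν M g p.K k) (q : Iχ F ν p g k)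
    (U : GaugeField (F.P p.K) k (SU N)) (V' : GaugeField (F.P p.K) (k + 1) (SU N)) :
    ∑ t ∈ Finset.univ.filter (fun t : LbOfRecord F ν p g k => q ∈ t.2.1),
        chiSeqOfRecord F N ν M g p.K (k + 1) (σOfRecord F ν M p g k s t) V' * ωOfRecord F N ν M p g k A₁ ζ s t U V' ≤
      (if SmallApproxFluct (sect3DataOfRecord F N ν M p g k s) (avOfRecord F N p.K) (2 * deltaOfRecord ν g k A₁) U V' q then (0 : ℝ) else 1) := by
  classical
  set χc : ℝ := (if SmallApproxFluct (sect3DataOfRecord F N ν M p g k s) (avOfRecord F N p.K) (2 * deltaOfRecord ν g k A₁) U V' q then (0 : ℝ) else 1) with hχc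
  have key : ∀ t : LbOfRecord F ν p g k,
      chiSeqOfRecord F N ν M g p.K (k + 1) (σOfRecord F ν M p g k s t) V' * ωOfRecord F N ν M p g k A₁ ζ s t U V' =
        aWeight F N ν M p g k s t.1 V' * (bWeight F N ν M p g k A₁ s t.1 t.2.1 U V' * ζ p g k s t.1 t.2.1 t.2.2 U V') := by
    intro t
    rw [ωOfRecord, ← mul_assoc, ← mul_assoc, front_absorb, mul_assoc]
  have hz : ∀ Pl Ql : Finset (Iχ F ν p g k), ∑ RS, ζ p g k s Pl Ql RS U V' = 1 := fun Pl Ql => hζ p g k s Pl Ql U V'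
  rw [Finset.sum_filter]
  calc ∑ t : LbOfRecord F ν p g k, (if q ∈ t.2.1 then
          chiSeqOfRecord F N ν M g p.K (k + 1) (σOfRecord F ν M p g k s t) V' * ωOfRecord F N ν M p g k A₁ ζ s t U V' else 0)
      = ∑ t : LbOfRecord F ν p g k, (if q ∈ t.2.1 then
          aWeight F N ν M p g k s t.1 V' * (bWeight F N ν M p g k A₁ s t.1 t.2.1 U V' * ζ p g k s t.1 t.2.1 t.2.2 U V') else 0) :=
        Finset.sum_congr rfl fun t _ => by rw [key t]
    _ = ∑ Pl : Finset (Iχ F ν p g k), ∑ Ql : Finset (Iχ F ν p g k), ∑ RS : Finset (Iχ F ν p g k) × Finset (Iχ F ν p g k), (if q ∈ Ql then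
          aWeight F N ν M p g k s Pl V' * (bWeight F N ν M p g k A₁ s Pl Ql U V' * ζ p g k s Pl Ql RS U V') else 0) := by
        rw [Fintype.sum_prod_type]
        refine Finset.sum_congr rfl fun Pl _ => ?_
        rw [Fintype.sum_prod_type]
    _ = ∑ Pl : Finset (Iχ F ν p g k), aWeight F N ν M p g k s Pl V' *
          ∑ Ql : Finset (Iχ F ν p g k), (if q ∈ Ql then bWeight F N ν M p g k A₁ s Pl Ql U V' else 0) := by
        refine Finset.sum_congr rfl fun Pl _ => ?_
        rw [Finset.mul_sum]
        refine Finset.sum_congr rfl fun Ql _ => ?_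
        by_cases hqQ : q ∈ Ql
        · simp only [if_pos hqQ, ← Finset.mul_sum, hz, mul_one]
        · simp only [if_neg hqQ, Finset.sum_const_zero, mul_zero]
    _ ≤ ∑ Pl : Finset (Iχ F ν p g k), aWeight F N ν M p g k s Pl V' * χc := by
        refine Finset.sum_le_sum fun Pl _ => mul_le_mul_of_nonneg_left ?_ (aWeight_nonneg F N ν M p g k s Pl V')
        rw [sum_ite_mem_bWeight_eq]
        by_cases hq : q ∈ qcubes F ν M p g k s Pl
        · rw [if_pos hq, hχc]
        · rw [if_neg hq, hχc]
          split_ifs <;> norm_num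
    _ = χc := by rw [← Finset.sum_mul, sum_aWeight, one_mul]

open scoped Classical in
/-- ★ **R-TYPE**: `Σ_{t : □ ∈ R_t} χ_{k+1}(σ s t)(V′)·ω s t (U,V′) = Σ_{P} Σ_{Q} a(P)(V′)·b(P,Q)(U,V′)·Σ_{(R,S) : □ ∈ R} ζ(P,Q,(R,S))(U,V′)` — the residual's own one-step mass on labels
whose (3.16) cube set contains `□` (no law of `ζ` beyond unity is in the tree; this is the quantity an R-type letter bounds). [bookkeeping] -/
theorem sum_filter_memR_chi_mul_ωOfRecord_eq (ζ : ZetaOfRecord F N ν M) (s : SeqOfRecord F ν M g p.K k) (q : Iχ F ν p g k)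
    (U : GaugeField (F.P p.K) k (SU N)) (V' : GaugeField (F.P p.K) (k + 1) (SU N)) :
    ∑ t ∈ Finset.univ.filter (fun t : LbOfRecord F ν p g k => q ∈ t.2.2.1),
        chiSeqOfRecord F N ν M g p.K (k + 1) (σOfRecord F ν M p g k s t) V' * ωOfRecord F N ν M p g k A₁ ζ s t U V' =
      ∑ Pl : Finset (Iχ F ν p g k), ∑ Ql : Finset (Iχ F ν p g k), aWeight F N ν M p g k s Pl V' * bWeight F N ν M p g k A₁ s Pl Ql U V' *
        ∑ RS ∈ Finset.univ.filter (fun RS : Finset (Iχ F ν p g k) × Finset (Iχ F ν p g k) => q ∈ RS.1), ζ p g k s Pl Ql RS U V' := by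
  classical
  have key : ∀ t : LbOfRecord F ν p g k,
      chiSeqOfRecord F N ν M g p.K (k + 1) (σOfRecord F ν M p g k s t) V' * ωOfRecord F N ν M p g k A₁ ζ s t U V' =
        aWeight F N ν M p g k s t.1 V' * bWeight F N ν M p g k A₁ s t.1 t.2.1 U V' * ζ p g k s t.1 t.2.1 t.2.2 U V' := by
    intro t
    rw [ωOfRecord, ← mul_assoc, ← mul_assoc, front_absorb]
  rw [Finset.sum_filter]
  calc ∑ t : LbOfRecord F ν p g k, (if q ∈ t.2.2.1 then
          chiSeqOfRecord F N ν M g p.K (k + 1) (σOfRecord F ν M p g k s t) V' * ωOfRecord F N ν M p g k A₁ ζ s t U V' else 0)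
      = ∑ t : LbOfRecord F ν p g k, (if q ∈ t.2.2.1 then
          aWeight F N ν M p g k s t.1 V' * bWeight F N ν M p g k A₁ s t.1 t.2.1 U V' * ζ p g k s t.1 t.2.1 t.2.2 U V' else 0) :=
        Finset.sum_congr rfl fun t _ => by rw [key t]
    _ = ∑ Pl : Finset (Iχ F ν p g k), ∑ Ql : Finset (Iχ F ν p g k), ∑ RS : Finset (Iχ F ν p g k) × Finset (Iχ F ν p g k), (if q ∈ RS.1 then
          aWeight F N ν M p g k s Pl V' * bWeight F N ν M p g k A₁ s Pl Ql U V' * ζ p g k s Pl Ql RS U V' else 0) := by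
        rw [Fintype.sum_prod_type]
        refine Finset.sum_congr rfl fun Pl _ => ?_
        rw [Fintype.sum_prod_type]
    _ = _ := by
        refine Finset.sum_congr rfl fun Pl _ => Finset.sum_congr rfl fun Ql _ => ?_
        rw [Finset.mul_sum, Finset.sum_filter]

end PerType

/-! ## §2 The near-label sum split over the candidate cubes -/

section Split

variable (F : T4Family) (N : ℕ) [NeZero N] (ν : Stage7Numerics) (M : ℕ) (A₁ : ℝ) (p : B12.RunParams) (g : ℕ → ℝ) (k : ℕ)

/-- [folklore] A sum of non-negative terms over a union is at most the sum of the two sums. -/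
private theorem sum_union_le_of_nonneg {κ : Type*} [DecidableEq κ] (A B : Finset κ) {f : κ → ℝ} (hf : ∀ x, 0 ≤ f x) :
    ∑ x ∈ A ∪ B, f x ≤ ∑ x ∈ A, f x + ∑ x ∈ B, f x := by
  have h := Finset.sum_union_inter (s₁ := A) (s₂ := B) (f := f)
  have hnn : 0 ≤ ∑ x ∈ A ∩ B, f x := Finset.sum_nonneg fun x _ => hf x
  linarith

/-- [folklore] A sum of non-negative terms over a `biUnion` is at most the sum of the sums. -/
private theorem sum_biUnion_le_sum_sum {ι κ : Type*} [DecidableEq κ] (S : Finset ι) (t : ι → Finset κ) {f : κ → ℝ} (hf : ∀ x, 0 ≤ f x) :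
    ∑ x ∈ S.biUnion t, f x ≤ ∑ i ∈ S, ∑ x ∈ t i, f x := by
  classical
  induction S using Finset.induction_on with
  | empty => simp
  | insert a S ha ih =>
    rw [Finset.biUnion_insert, Finset.sum_insert ha]
    exact (sum_union_le_of_nonneg _ _ hf).trans (by linarith)

open scoped Classical in
/-- ★★ **THE NEAR-LABEL SUM SPLIT**: with `N_c = {□ : ∃ y ∈ □, ∃ x ∈ c, ∀ i, coordDist y x i + 1 ≤ 25·sideD k}` and `T_c = {t : ∃ □ ∈ P_t ∪ Q_t ∪ R_t, □ ∈ N_c}` (the least label set of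
`…Far`): `Σ_{t ∈ T_c} χ_{k+1}(σ s t)·ω s t ≤ Σ_{□ ∈ N_c} [(1 − χ_□(V′)) + χ′ᶜ_□(U,V′) + ζR_□(U,V′)]` pointwise, under ζ-unity and `0 ≤ ζ` (`T_c ⊆ ⋃_{□ ∈ N_c}` of the three per-type label
sets, label terms `≥ 0`, §1). [bookkeeping] -/
theorem nearLabelSum_le_split {ζ : ZetaOfRecord F N ν M} (hζ : IsZetaUnity F N ν M ζ) (hζ0 : ∀ p g k s Pl Ql RS U V', 0 ≤ ζ p g k s Pl Ql RS U V')
    (s : SeqOfRecord F ν M g p.K k) (c : Set (Site (F.P p.K) 0)) (U : GaugeField (F.P p.K) k (SU N)) (V' : GaugeField (F.P p.K) (k + 1) (SU N)) :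
    ∑ t ∈ Finset.univ.filter (fun t : LbOfRecord F ν p g k => ∃ q ∈ t.1 ∪ (t.2.1 ∪ t.2.2.1), ∃ y ∈ cubeχ F ν p g k q, ∃ x ∈ c,
        ∀ i, coordDist y x i + 1 ≤ 25 * sideD F ν M p g k),
        chiSeqOfRecord F N ν M g p.K (k + 1) (σOfRecord F ν M p g k s t) V' * ωOfRecord F N ν M p g k A₁ ζ s t U V' ≤
      ∑ q ∈ Finset.univ.filter (fun q : Iχ F ν p g k => ∃ y ∈ cubeχ F ν p g k q, ∃ x ∈ c, ∀ i, coordDist y x i + 1 ≤ 25 * sideD F ν M p g k),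
        ((1 - chiFactor F N ν p g k q V') +
          (if SmallApproxFluct (sect3DataOfRecord F N ν M p g k s) (avOfRecord F N p.K) (2 * deltaOfRecord ν g k A₁) U V' q then (0 : ℝ) else 1) +
          ∑ Pl : Finset (Iχ F ν p g k), ∑ Ql : Finset (Iχ F ν p g k), aWeight F N ν M p g k s Pl V' * bWeight F N ν M p g k A₁ s Pl Ql U V' *
            ∑ RS ∈ Finset.univ.filter (fun RS : Finset (Iχ F ν p g k) × Finset (Iχ F ν p g k) => q ∈ RS.1), ζ p g k s Pl Ql RS U V') := by
  -- name the near-cube set (opaquely) and the label term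
  obtain ⟨Nc, hNc⟩ : ∃ Nc : Finset (Iχ F ν p g k),
      Finset.univ.filter (fun q : Iχ F ν p g k => ∃ y ∈ cubeχ F ν p g k q, ∃ x ∈ c, ∀ i, coordDist y x i + 1 ≤ 25 * sideD F ν M p g k) = Nc := ⟨_, rfl⟩
  obtain ⟨gl, hgl⟩ : ∃ gl : LbOfRecord F ν p g k → ℝ,
      (fun t => chiSeqOfRecord F N ν M g p.K (k + 1) (σOfRecord F ν M p g k s t) V' * ωOfRecord F N ν M p g k A₁ ζ s t U V') = gl := ⟨_, rfl⟩
  have hgl0 : ∀ t, 0 ≤ gl t := fun t => by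
    rw [← hgl]
    exact mul_nonneg (chiSeqOfRecord_nonneg F N ν M g p.K (k + 1) _ V') (ωOfRecord_nonneg F N ν M p g k A₁ hζ0 s t U V')
  -- per cube: the three per-type label sums (§1), stated with `gl`
  have hP : ∀ q, ∑ t ∈ Finset.univ.filter (fun t : LbOfRecord F ν p g k => q ∈ t.1), gl t ≤ 1 - chiFactor F N ν p g k q V' := fun q => by
    rw [← hgl]; exact sum_filter_memP_chi_mul_ωOfRecord_le F N ν M A₁ p g k hζ s q U V'
  have hQ : ∀ q, ∑ t ∈ Finset.univ.filter (fun t : LbOfRecord F ν p g k => q ∈ t.2.1), gl t ≤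
      (if SmallApproxFluct (sect3DataOfRecord F N ν M p g k s) (avOfRecord F N p.K) (2 * deltaOfRecord ν g k A₁) U V' q then (0 : ℝ) else 1) := fun q => by
    rw [← hgl]; exact sum_filter_memQ_chi_mul_ωOfRecord_le F N ν M A₁ p g k hζ s q U V'
  have hR : ∀ q, ∑ t ∈ Finset.univ.filter (fun t : LbOfRecord F ν p g k => q ∈ t.2.2.1), gl t =
      ∑ Pl : Finset (Iχ F ν p g k), ∑ Ql : Finset (Iχ F ν p g k), aWeight F N ν M p g k s Pl V' * bWeight F N ν M p g k A₁ s Pl Ql U V' *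
        ∑ RS ∈ Finset.univ.filter (fun RS : Finset (Iχ F ν p g k) × Finset (Iχ F ν p g k) => q ∈ RS.1), ζ p g k s Pl Ql RS U V' := fun q => by
    rw [← hgl]; exact sum_filter_memR_chi_mul_ωOfRecord_eq F N ν M A₁ p g k ζ s q U V'
  -- the least label set lies in the union over the near cubes of the three per-type label sets
  have hsub : Finset.univ.filter (fun t : LbOfRecord F ν p g k => ∃ q ∈ t.1 ∪ (t.2.1 ∪ t.2.2.1), ∃ y ∈ cubeχ F ν p g k q, ∃ x ∈ c,
        ∀ i, coordDist y x i + 1 ≤ 25 * sideD F ν M p g k) ⊆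
      Nc.biUnion (fun q => Finset.univ.filter (fun t : LbOfRecord F ν p g k => q ∈ t.1) ∪
        (Finset.univ.filter (fun t : LbOfRecord F ν p g k => q ∈ t.2.1) ∪ Finset.univ.filter (fun t : LbOfRecord F ν p g k => q ∈ t.2.2.1))) := by
    intro t ht
    obtain ⟨q, hq, hnear⟩ := (Finset.mem_filter.1 ht).2
    refine Finset.mem_biUnion.2 ⟨q, by rw [← hNc]; exact Finset.mem_filter.2 ⟨Finset.mem_univ _, hnear⟩, ?_⟩
    simp only [Finset.mem_union, Finset.mem_filter, Finset.mem_univ, true_and] at hq ⊢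
    exact hq
  rw [hNc]
  rw [show (∑ t ∈ Finset.univ.filter (fun t : LbOfRecord F ν p g k => ∃ q ∈ t.1 ∪ (t.2.1 ∪ t.2.2.1), ∃ y ∈ cubeχ F ν p g k q, ∃ x ∈ c,
        ∀ i, coordDist y x i + 1 ≤ 25 * sideD F ν M p g k),
        chiSeqOfRecord F N ν M g p.K (k + 1) (σOfRecord F ν M p g k s t) V' * ωOfRecord F N ν M p g k A₁ ζ s t U V') =
      ∑ t ∈ Finset.univ.filter (fun t : LbOfRecord F ν p g k => ∃ q ∈ t.1 ∪ (t.2.1 ∪ t.2.2.1), ∃ y ∈ cubeχ F ν p g k q, ∃ x ∈ c,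
        ∀ i, coordDist y x i + 1 ≤ 25 * sideD F ν M p g k), gl t from by rw [← hgl]]
  -- per cube: the union bound over the three types, then §1 (linear arithmetic over the five sums as atoms)
  have hq3 : ∀ q : Iχ F ν p g k,
      ∑ x ∈ Finset.univ.filter (fun t : LbOfRecord F ν p g k => q ∈ t.1) ∪
          (Finset.univ.filter (fun t : LbOfRecord F ν p g k => q ∈ t.2.1) ∪ Finset.univ.filter (fun t : LbOfRecord F ν p g k => q ∈ t.2.2.1)), gl x ≤
        (1 - chiFactor F N ν p g k q V') +
          (if SmallApproxFluct (sect3DataOfRecord F N ν M p g k s) (avOfRecord F N p.K) (2 * deltaOfRecord ν g k A₁) U V' q then (0 : ℝ) else 1) +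
          ∑ Pl : Finset (Iχ F ν p g k), ∑ Ql : Finset (Iχ F ν p g k), aWeight F N ν M p g k s Pl V' * bWeight F N ν M p g k A₁ s Pl Ql U V' *
            ∑ RS ∈ Finset.univ.filter (fun RS : Finset (Iχ F ν p g k) × Finset (Iχ F ν p g k) => q ∈ RS.1), ζ p g k s Pl Ql RS U V' := by
    intro q
    have h1 := sum_union_le_of_nonneg (Finset.univ.filter (fun t : LbOfRecord F ν p g k => q ∈ t.1))
      (Finset.univ.filter (fun t : LbOfRecord F ν p g k => q ∈ t.2.1) ∪ Finset.univ.filter (fun t : LbOfRecord F ν p g k => q ∈ t.2.2.1)) hgl0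
    have h2 := sum_union_le_of_nonneg (Finset.univ.filter (fun t : LbOfRecord F ν p g k => q ∈ t.2.1))
      (Finset.univ.filter (fun t : LbOfRecord F ν p g k => q ∈ t.2.2.1)) hgl0
    have h3 := hP q
    have h4 := hQ q
    have h5 := hR q
    linarith
  calc ∑ t ∈ Finset.univ.filter (fun t : LbOfRecord F ν p g k => ∃ q ∈ t.1 ∪ (t.2.1 ∪ t.2.2.1), ∃ y ∈ cubeχ F ν p g k q, ∃ x ∈ c,
          ∀ i, coordDist y x i + 1 ≤ 25 * sideD F ν M p g k), gl t
      ≤ ∑ t ∈ Nc.biUnion (fun q => Finset.univ.filter (fun t : LbOfRecord F ν p g k => q ∈ t.1) ∪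
          (Finset.univ.filter (fun t : LbOfRecord F ν p g k => q ∈ t.2.1) ∪ Finset.univ.filter (fun t : LbOfRecord F ν p g k => q ∈ t.2.2.1))), gl t :=
        Finset.sum_le_sum_of_subset_of_nonneg hsub fun t _ _ => hgl0 t
    _ ≤ ∑ q ∈ Nc, ∑ t ∈ Finset.univ.filter (fun t : LbOfRecord F ν p g k => q ∈ t.1) ∪
          (Finset.univ.filter (fun t : LbOfRecord F ν p g k => q ∈ t.2.1) ∪ Finset.univ.filter (fun t : LbOfRecord F ν p g k => q ∈ t.2.2.1)), gl t :=
        sum_biUnion_le_sum_sum Nc _ hgl0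
    _ ≤ _ := Finset.sum_le_sum fun q _ => hq3 q

end Split

/-! ## §3 The repaired per-history letter from THREE printed-kind letters -/

section Dressed

variable {F : T4Family} {N : ℕ} [NeZero N]

open scoped Classical in
/-- ★★★ **THE REPAIRED PER-HISTORY FRESH LETTER FROM THE THREE SINGLE-CUBE LETTERS.**  At a live-pinned Stage-9 tuple under (H-U), the ζ-laws, `0 ≤ ζ`, `0 < sideD k`, for a history `s`
and a site set `c` far from `Z_k(s)`, with `N_c` the χ_{k+1}-cubes within `25·sideD k` of `c`: GIVEN (displayed integrable) hP «`∫ χ_k(s)·slot_k(s)·Σ_{□∈N_c}(1 − χ_□(avg U)) ≤ δP·cw_k(s)`»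
((3.2): a NEW small-field failure near `c`), hQ «`∫ χ_k(s)·slot_k(s)·Σ_{□∈N_c} χ′ᶜ_□(U, avg U) ≤ δQ·cw_k(s)`» ((3.3): a large approximate fluctuation near `c`), hR «`∫ χ_k(s)·slot_k(s)·Σ_{□∈N_c}
ζR_□(U, avg U) ≤ δR·cw_k(s)`» ((3.16): the residual's mass on labels with `□ ∈ R`): `Σ_{s′ : s′.init = s, c ∩ Z_{k+1}(s′) ≠ ∅} cw_{k+1}(s′) ≤ (δP + δQ + δR)·cw_k(s)`.  The three letters are
[LF-II] (1.79) p. 383's new-region factors, one per label type, read on ONE history's class density — ESTIMATES, nobody's theorems today. [bookkeeping] -/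
theorem sum_meets_classWeightOfDatum₉_succ_le_of_threeLetters_of_ppSelLive (ϑ : Stage9Params F N) (E : B12.RunParams → ℝ)
    (hsel : ϑ.ppSel = ppSelLiveOfRecord F N ϑ.ν ϑ.τ9 E (wOfRecord₉ F N ϑ))
    (hU : LocalBgMeasurable F N ϑ.ν) (hζu : IsZetaUnity F N ϑ.ν ϑ.τ9.M ϑ.ζ) (hζa : IsZetaAbsLeOne F N ϑ.ν ϑ.τ9.M ϑ.ζ)
    (hζm : ZetaMeasurable F N ϑ.ζ) (hζ0 : ∀ p g k s Pl Ql RS U V', 0 ≤ ϑ.ζ p g k s Pl Ql RS U V')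
    (D : FiniteEpsData F (SU N)) (hD : D.AvgMeasurable) (g₀ : ℕ → ℝ) (os : List (ULoop F)) (p : B12.RunParams) (g : ℕ → ℝ) (hg : g 0 = g₀ p.K)
    (k : ℕ) (hk : k < p.K) (hsD : 0 < sideD F ϑ.ν ϑ.τ9.M p g k) (t : ℝ) (s : SeqOfRecord F ϑ.ν ϑ.τ9.M g p.K k)
    (c : Set (Site (F.P p.K) 0)) (hfar : ∀ x ∈ c, ∀ z ∈ Zreg F ϑ.ν ϑ.τ9.M p g k s, ∃ i, 25 * sideD F ϑ.ν ϑ.τ9.M p g k ≤ coordDist z x i) {δP δQ δR : ℝ}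
    (hIP : Integrable (fun U => chiSeqOfRecord F N ϑ.ν ϑ.τ9.M g p.K k s U * dressedSlotsOfDatum₉ F N ϑ D g₀ os t p g k s U *
      ∑ q ∈ Finset.univ.filter (fun q : Iχ F ϑ.ν p g k => ∃ y ∈ cubeχ F ϑ.ν p g k q, ∃ x ∈ c, ∀ i, coordDist y x i + 1 ≤ 25 * sideD F ϑ.ν ϑ.τ9.M p g k),
        (1 - chiFactor F N ϑ.ν p g k q ((avOfRecord F N p.K k).avg U))) (fieldMeasure (F.P p.K) k (SU N)))
    (hIQ : Integrable (fun U => chiSeqOfRecord F N ϑ.ν ϑ.τ9.M g p.K k s U * dressedSlotsOfDatum₉ F N ϑ D g₀ os t p g k s U *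
      ∑ q ∈ Finset.univ.filter (fun q : Iχ F ϑ.ν p g k => ∃ y ∈ cubeχ F ϑ.ν p g k q, ∃ x ∈ c, ∀ i, coordDist y x i + 1 ≤ 25 * sideD F ϑ.ν ϑ.τ9.M p g k),
        (if SmallApproxFluct (sect3DataOfRecord F N ϑ.ν ϑ.τ9.M p g k s) (avOfRecord F N p.K) (2 * deltaOfRecord ϑ.ν g k ϑ.A₁) U ((avOfRecord F N p.K k).avg U) q
          then (0 : ℝ) else 1)) (fieldMeasure (F.P p.K) k (SU N)))
    (hIR : Integrable (fun U => chiSeqOfRecord F N ϑ.ν ϑ.τ9.M g p.K k s U * dressedSlotsOfDatum₉ F N ϑ D g₀ os t p g k s U *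
      ∑ q ∈ Finset.univ.filter (fun q : Iχ F ϑ.ν p g k => ∃ y ∈ cubeχ F ϑ.ν p g k q, ∃ x ∈ c, ∀ i, coordDist y x i + 1 ≤ 25 * sideD F ϑ.ν ϑ.τ9.M p g k),
        ∑ Pl : Finset (Iχ F ϑ.ν p g k), ∑ Ql : Finset (Iχ F ϑ.ν p g k),
          aWeight F N ϑ.ν ϑ.τ9.M p g k s Pl ((avOfRecord F N p.K k).avg U) * bWeight F N ϑ.ν ϑ.τ9.M p g k ϑ.A₁ s Pl Ql U ((avOfRecord F N p.K k).avg U) *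
          ∑ RS ∈ Finset.univ.filter (fun RS : Finset (Iχ F ϑ.ν p g k) × Finset (Iχ F ϑ.ν p g k) => q ∈ RS.1),
            ϑ.ζ p g k s Pl Ql RS U ((avOfRecord F N p.K k).avg U)) (fieldMeasure (F.P p.K) k (SU N)))
    (hP : ∫ U, chiSeqOfRecord F N ϑ.ν ϑ.τ9.M g p.K k s U * dressedSlotsOfDatum₉ F N ϑ D g₀ os t p g k s U *
      ∑ q ∈ Finset.univ.filter (fun q : Iχ F ϑ.ν p g k => ∃ y ∈ cubeχ F ϑ.ν p g k q, ∃ x ∈ c, ∀ i, coordDist y x i + 1 ≤ 25 * sideD F ϑ.ν ϑ.τ9.M p g k),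
        (1 - chiFactor F N ϑ.ν p g k q ((avOfRecord F N p.K k).avg U)) ∂(fieldMeasure (F.P p.K) k (SU N))
      ≤ δP * classWeightOfDatum₉ F N ϑ D g₀ os p g k t s)
    (hQ : ∫ U, chiSeqOfRecord F N ϑ.ν ϑ.τ9.M g p.K k s U * dressedSlotsOfDatum₉ F N ϑ D g₀ os t p g k s U *
      ∑ q ∈ Finset.univ.filter (fun q : Iχ F ϑ.ν p g k => ∃ y ∈ cubeχ F ϑ.ν p g k q, ∃ x ∈ c, ∀ i, coordDist y x i + 1 ≤ 25 * sideD F ϑ.ν ϑ.τ9.M p g k),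
        (if SmallApproxFluct (sect3DataOfRecord F N ϑ.ν ϑ.τ9.M p g k s) (avOfRecord F N p.K) (2 * deltaOfRecord ϑ.ν g k ϑ.A₁) U ((avOfRecord F N p.K k).avg U) q
          then (0 : ℝ) else 1) ∂(fieldMeasure (F.P p.K) k (SU N))
      ≤ δQ * classWeightOfDatum₉ F N ϑ D g₀ os p g k t s)
    (hR : ∫ U, chiSeqOfRecord F N ϑ.ν ϑ.τ9.M g p.K k s U * dressedSlotsOfDatum₉ F N ϑ D g₀ os t p g k s U *
      ∑ q ∈ Finset.univ.filter (fun q : Iχ F ϑ.ν p g k => ∃ y ∈ cubeχ F ϑ.ν p g k q, ∃ x ∈ c, ∀ i, coordDist y x i + 1 ≤ 25 * sideD F ϑ.ν ϑ.τ9.M p g k),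
        ∑ Pl : Finset (Iχ F ϑ.ν p g k), ∑ Ql : Finset (Iχ F ϑ.ν p g k),
          aWeight F N ϑ.ν ϑ.τ9.M p g k s Pl ((avOfRecord F N p.K k).avg U) * bWeight F N ϑ.ν ϑ.τ9.M p g k ϑ.A₁ s Pl Ql U ((avOfRecord F N p.K k).avg U) *
          ∑ RS ∈ Finset.univ.filter (fun RS : Finset (Iχ F ϑ.ν p g k) × Finset (Iχ F ϑ.ν p g k) => q ∈ RS.1),
            ϑ.ζ p g k s Pl Ql RS U ((avOfRecord F N p.K k).avg U) ∂(fieldMeasure (F.P p.K) k (SU N))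
      ≤ δR * classWeightOfDatum₉ F N ϑ D g₀ os p g k t s) :
    ∑ s' ∈ Finset.univ.filter (fun s' : SeqOfRecord F ϑ.ν ϑ.τ9.M g p.K (k + 1) => s'.init = s ∧ ∃ x ∈ c, x ∈ (s'.Λ (k + 1))ᶜ),
        classWeightOfDatum₉ F N ϑ D g₀ os p g (k + 1) t s' ≤ (δP + δQ + δR) * classWeightOfDatum₉ F N ϑ D g₀ os p g k t s := by
  have hw0 : ∀ k s' U V', 0 ≤ wOfRecord₉ F N ϑ p g k s' U V' := fun k s' U V' => wOfRecord_nonneg F N ϑ.ν ϑ.τ9.M p g k ϑ.A₁ hζ0 s' U V'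
  have hd0 := dressedSlotsOfDatum₉_nonneg F N ϑ D g₀ os p g hw0 t
  -- `…Far` at the least label set `T_c`
  have hfar' := sum_meets_classWeightOfDatum₉_succ_le_of_ppSelLive ϑ E hsel hU hζa hζm hζ0 D hD g₀ os p g hg k hk hsD t s c hfar
    (Finset.univ.filter (fun lb : LbOfRecord F ϑ.ν p g k => ∃ q ∈ lb.1 ∪ (lb.2.1 ∪ lb.2.2.1), ∃ y ∈ cubeχ F ϑ.ν p g k q, ∃ x ∈ c,
      ∀ i, coordDist y x i + 1 ≤ 25 * sideD F ϑ.ν ϑ.τ9.M p g k)) (fun lb h => Finset.mem_filter.2 ⟨Finset.mem_univ _, h⟩)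
  refine hfar'.trans ?_
  -- the split of §2, inside the integral (non-negative integrand; the three pieces displayed integrable)
  have hsplit : ∀ U, chiSeqOfRecord F N ϑ.ν ϑ.τ9.M g p.K k s U * dressedSlotsOfDatum₉ F N ϑ D g₀ os t p g k s U *
      ∑ lb ∈ Finset.univ.filter (fun lb : LbOfRecord F ϑ.ν p g k => ∃ q ∈ lb.1 ∪ (lb.2.1 ∪ lb.2.2.1), ∃ y ∈ cubeχ F ϑ.ν p g k q, ∃ x ∈ c,
          ∀ i, coordDist y x i + 1 ≤ 25 * sideD F ϑ.ν ϑ.τ9.M p g k),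
        chiSeqOfRecord F N ϑ.ν ϑ.τ9.M g p.K (k + 1) (σOfRecord F ϑ.ν ϑ.τ9.M p g k s lb) ((avOfRecord F N p.K k).avg U) *
          ωOfRecord F N ϑ.ν ϑ.τ9.M p g k ϑ.A₁ ϑ.ζ s lb U ((avOfRecord F N p.K k).avg U) ≤
      (chiSeqOfRecord F N ϑ.ν ϑ.τ9.M g p.K k s U * dressedSlotsOfDatum₉ F N ϑ D g₀ os t p g k s U *
      ∑ q ∈ Finset.univ.filter (fun q : Iχ F ϑ.ν p g k => ∃ y ∈ cubeχ F ϑ.ν p g k q, ∃ x ∈ c, ∀ i, coordDist y x i + 1 ≤ 25 * sideD F ϑ.ν ϑ.τ9.M p g k),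
        (1 - chiFactor F N ϑ.ν p g k q ((avOfRecord F N p.K k).avg U))) +
      (chiSeqOfRecord F N ϑ.ν ϑ.τ9.M g p.K k s U * dressedSlotsOfDatum₉ F N ϑ D g₀ os t p g k s U *
      ∑ q ∈ Finset.univ.filter (fun q : Iχ F ϑ.ν p g k => ∃ y ∈ cubeχ F ϑ.ν p g k q, ∃ x ∈ c, ∀ i, coordDist y x i + 1 ≤ 25 * sideD F ϑ.ν ϑ.τ9.M p g k),
        (if SmallApproxFluct (sect3DataOfRecord F N ϑ.ν ϑ.τ9.M p g k s) (avOfRecord F N p.K) (2 * deltaOfRecord ϑ.ν g k ϑ.A₁) U ((avOfRecord F N p.K k).avg U) q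
          then (0 : ℝ) else 1)) +
      (chiSeqOfRecord F N ϑ.ν ϑ.τ9.M g p.K k s U * dressedSlotsOfDatum₉ F N ϑ D g₀ os t p g k s U *
      ∑ q ∈ Finset.univ.filter (fun q : Iχ F ϑ.ν p g k => ∃ y ∈ cubeχ F ϑ.ν p g k q, ∃ x ∈ c, ∀ i, coordDist y x i + 1 ≤ 25 * sideD F ϑ.ν ϑ.τ9.M p g k),
        ∑ Pl : Finset (Iχ F ϑ.ν p g k), ∑ Ql : Finset (Iχ F ϑ.ν p g k),
          aWeight F N ϑ.ν ϑ.τ9.M p g k s Pl ((avOfRecord F N p.K k).avg U) * bWeight F N ϑ.ν ϑ.τ9.M p g k ϑ.A₁ s Pl Ql U ((avOfRecord F N p.K k).avg U) *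
          ∑ RS ∈ Finset.univ.filter (fun RS : Finset (Iχ F ϑ.ν p g k) × Finset (Iχ F ϑ.ν p g k) => q ∈ RS.1),
            ϑ.ζ p g k s Pl Ql RS U ((avOfRecord F N p.K k).avg U)) := by
    intro U
    have hm : 0 ≤ chiSeqOfRecord F N ϑ.ν ϑ.τ9.M g p.K k s U * dressedSlotsOfDatum₉ F N ϑ D g₀ os t p g k s U :=
      mul_nonneg (chiSeqOfRecord_nonneg F N ϑ.ν ϑ.τ9.M g p.K k s U) (hd0 k s U)
    have h := mul_le_mul_of_nonneg_left (nearLabelSum_le_split F N ϑ.ν ϑ.τ9.M ϑ.A₁ p g k hζu hζ0 s c U ((avOfRecord F N p.K k).avg U)) hm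
    refine h.trans (le_of_eq ?_)
    rw [Finset.sum_add_distrib, Finset.sum_add_distrib]
    ring
  have hnn : ∀ U, 0 ≤ chiSeqOfRecord F N ϑ.ν ϑ.τ9.M g p.K k s U * dressedSlotsOfDatum₉ F N ϑ D g₀ os t p g k s U *
      ∑ lb ∈ Finset.univ.filter (fun lb : LbOfRecord F ϑ.ν p g k => ∃ q ∈ lb.1 ∪ (lb.2.1 ∪ lb.2.2.1), ∃ y ∈ cubeχ F ϑ.ν p g k q, ∃ x ∈ c,
          ∀ i, coordDist y x i + 1 ≤ 25 * sideD F ϑ.ν ϑ.τ9.M p g k),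
        chiSeqOfRecord F N ϑ.ν ϑ.τ9.M g p.K (k + 1) (σOfRecord F ϑ.ν ϑ.τ9.M p g k s lb) ((avOfRecord F N p.K k).avg U) *
          ωOfRecord F N ϑ.ν ϑ.τ9.M p g k ϑ.A₁ ϑ.ζ s lb U ((avOfRecord F N p.K k).avg U) := fun U =>
    mul_nonneg (mul_nonneg (chiSeqOfRecord_nonneg F N ϑ.ν ϑ.τ9.M g p.K k s U) (hd0 k s U))
      (nearLabelSum_nonneg F N ϑ.ν ϑ.τ9.M ϑ.A₁ p g k hζ0 s _ U _)
  have hIPQ : Integrable (fun U => (chiSeqOfRecord F N ϑ.ν ϑ.τ9.M g p.K k s U * dressedSlotsOfDatum₉ F N ϑ D g₀ os t p g k s U *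
      ∑ q ∈ Finset.univ.filter (fun q : Iχ F ϑ.ν p g k => ∃ y ∈ cubeχ F ϑ.ν p g k q, ∃ x ∈ c, ∀ i, coordDist y x i + 1 ≤ 25 * sideD F ϑ.ν ϑ.τ9.M p g k),
        (1 - chiFactor F N ϑ.ν p g k q ((avOfRecord F N p.K k).avg U))) +
    (chiSeqOfRecord F N ϑ.ν ϑ.τ9.M g p.K k s U * dressedSlotsOfDatum₉ F N ϑ D g₀ os t p g k s U *
      ∑ q ∈ Finset.univ.filter (fun q : Iχ F ϑ.ν p g k => ∃ y ∈ cubeχ F ϑ.ν p g k q, ∃ x ∈ c, ∀ i, coordDist y x i + 1 ≤ 25 * sideD F ϑ.ν ϑ.τ9.M p g k),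
        (if SmallApproxFluct (sect3DataOfRecord F N ϑ.ν ϑ.τ9.M p g k s) (avOfRecord F N p.K) (2 * deltaOfRecord ϑ.ν g k ϑ.A₁) U ((avOfRecord F N p.K k).avg U) q
          then (0 : ℝ) else 1))) (fieldMeasure (F.P p.K) k (SU N)) := hIP.add hIQ
  have hI : Integrable (fun U => (chiSeqOfRecord F N ϑ.ν ϑ.τ9.M g p.K k s U * dressedSlotsOfDatum₉ F N ϑ D g₀ os t p g k s U *
      ∑ q ∈ Finset.univ.filter (fun q : Iχ F ϑ.ν p g k => ∃ y ∈ cubeχ F ϑ.ν p g k q, ∃ x ∈ c, ∀ i, coordDist y x i + 1 ≤ 25 * sideD F ϑ.ν ϑ.τ9.M p g k),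
        (1 - chiFactor F N ϑ.ν p g k q ((avOfRecord F N p.K k).avg U))) +
    (chiSeqOfRecord F N ϑ.ν ϑ.τ9.M g p.K k s U * dressedSlotsOfDatum₉ F N ϑ D g₀ os t p g k s U *
      ∑ q ∈ Finset.univ.filter (fun q : Iχ F ϑ.ν p g k => ∃ y ∈ cubeχ F ϑ.ν p g k q, ∃ x ∈ c, ∀ i, coordDist y x i + 1 ≤ 25 * sideD F ϑ.ν ϑ.τ9.M p g k),
        (if SmallApproxFluct (sect3DataOfRecord F N ϑ.ν ϑ.τ9.M p g k s) (avOfRecord F N p.K) (2 * deltaOfRecord ϑ.ν g k ϑ.A₁) U ((avOfRecord F N p.K k).avg U) q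
          then (0 : ℝ) else 1)) +
    (chiSeqOfRecord F N ϑ.ν ϑ.τ9.M g p.K k s U * dressedSlotsOfDatum₉ F N ϑ D g₀ os t p g k s U *
      ∑ q ∈ Finset.univ.filter (fun q : Iχ F ϑ.ν p g k => ∃ y ∈ cubeχ F ϑ.ν p g k q, ∃ x ∈ c, ∀ i, coordDist y x i + 1 ≤ 25 * sideD F ϑ.ν ϑ.τ9.M p g k),
        ∑ Pl : Finset (Iχ F ϑ.ν p g k), ∑ Ql : Finset (Iχ F ϑ.ν p g k),
          aWeight F N ϑ.ν ϑ.τ9.M p g k s Pl ((avOfRecord F N p.K k).avg U) * bWeight F N ϑ.ν ϑ.τ9.M p g k ϑ.A₁ s Pl Ql U ((avOfRecord F N p.K k).avg U) *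
          ∑ RS ∈ Finset.univ.filter (fun RS : Finset (Iχ F ϑ.ν p g k) × Finset (Iχ F ϑ.ν p g k) => q ∈ RS.1),
            ϑ.ζ p g k s Pl Ql RS U ((avOfRecord F N p.K k).avg U))) (fieldMeasure (F.P p.K) k (SU N)) := hIPQ.add hIR
  refine (integral_mono_of_nonneg (ae_of_all _ hnn) hI (ae_of_all _ hsplit)).trans ?_
  rw [integral_add hIPQ hIR, integral_add hIP hIQ]
  have := add_le_add (add_le_add hP hQ) hR
  linarith

end Dressed

end YMDAG.UVSplit

end
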